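import Mathlib.AlgebraicGeometry.EllipticCurve.Weierstrass
import Mathlib.AlgebraicGeometry.EllipticCurve.VariableChange
import HarnessLib

/-!
# The integral model `[1, −1, 0, −2, −1]` of `X₀(49) = 49a1` is the same curve under every reading, and its invariants
# (`b₂ = −3`, `b₄ = −4`, `b₆ = −4`, `b₈ = −1`, `c₄ = 105`, `c₆ = 1323`, `Δ = −7³`, `g₂ = 35/4`, `g₃ = 49/8`)

Topic `NumberTheory/EllipticCurves` (theorems only; no definition, no named fact, no instance).  A Weierstrass model with INTEGER
coefficients has a canonical copy over every commutative ring, and ring homomorphisms carry copies to copies: for `W₀ : WeierstrassCurve ℤ`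
and any `f : A →+* B`, `(W₀ ⊗ A)^f = W₀ ⊗ B` (`WeierstrassCurve.map_map` and the initiality of `ℤ`).  For the model
`[1, −1, 0, −2, −1]` of the curve `49a1 = X₀(49)` (Cremona's label; the tree's `cm7`, CM by `𝒪_K`, `K = ℚ(√−7)`, `j = −3375`) this says that
the complex model read back into `ℂ₂` along `ι⁻¹ : ℂ ≅ ℚ̄₂ ⊂ ℂ₂` and the `ℤ₂`-model read into `ℂ₂` along `ℤ₂ → K_v → ℂ₂` are the SAME
Weierstrass curve over `ℂ₂` — the «model hypothesis» `hW` of the `p`-adic/complex seam of the two-variable measure lane of cell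
`bsd-print-cf2` (`Summits/…/PrintCf2RubinValueTwoKatzMeasureJZeroSeamPerUnit.map_relCoatesWiles_eq_of_bridge`, binders `WR`, `V`, `φC`,
`φF`, `ιp`), whatever the four ring maps are.  The file also records the invariants of the model over an arbitrary commutative ring
(`b₂, b₄, b₆, b₈, c₄, c₆, Δ`, Cremona Table 1 / Silverman ATAEC App. A §3) and, in characteristic zero, the Eisenstein pair
`(c₄/12, c₆/216) = (35/4, 49/8)` of the lattice of its Néron differential (the `hg₂`/`hg₃` numbers of the same seam) and `j = −3375`.

* `WeierstrassCurve.map_map_intCast`, `WeierstrassCurve.map_intCast_eq_map_intCast` — integer models under ring maps;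
* `cm7Model_map` — `([1,−1,0,−2,−1] : WeierstrassCurve A).map f = [1,−1,0,−2,−1]`; `cm7Model_map_map_eq_map_map` — the seam's `hW` shape;
* `cm7Model_b₂ … cm7Model_Δ`, `cm7Model_c₄_div_twelve`, `cm7Model_c₆_div`, `cm7Model_j_mul_Δ` / `cm7Model_c₄_pow_three_div_Δ`.

Cell `bsd-print-cf2`, width seat `bsd-line-cf2-p1-w7` g15 (piece (W) of the per-unit hypotheses of the `j = 0` seam); nothing here closes a
crux; no summit statement is proved; BSD is not proved by any of this.

## References
* [Cremona1997] J. E. Cremona, *Algorithms for Modular Elliptic Curves*, 2nd ed. (1997), Table 1, curve 49a1 (`[1,−1,0,−2,−1]`,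
  `Δ = −343`, `j = −3375`).
* [SilvermanATAEC1994] J. H. Silverman, *Advanced Topics in the Arithmetic of Elliptic Curves*, GTM 151 (1994), App. A §3 (row `D = −7`).
* [SilvermanAEC2009] J. H. Silverman, *The Arithmetic of Elliptic Curves*, 2nd ed. (2009), III §1 (the quantities `b_i`, `c_i`, `Δ`, `j`;
  base change of a Weierstrass equation along a ring map).
-/

namespace WeierstrassCurve

variable {A B C D : Type*} [CommRing A] [CommRing B] [CommRing C] [CommRing D]

/-- **An integer model is carried to the integer model by every ring map**: `(W₀ ⊗ A)^f = W₀ ⊗ B`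
(`map_map` and `ℤ` initial). [cite: SilvermanAEC2009, III §1 (base change of Weierstrass equations)] -/
theorem map_map_intCast (W₀ : WeierstrassCurve ℤ) (f : A →+* B) :
    (W₀.map (Int.castRingHom A)).map f = W₀.map (Int.castRingHom B) := by
  rw [map_map, RingHom.ext_int (f.comp (Int.castRingHom A)) (Int.castRingHom B)]

/-- Any two readings of an integer model in a common ring agree: `(W₀ ⊗ A)^f = (W₀ ⊗ B)^g` for `f : A → C`, `g : B → C`.
[cite: SilvermanAEC2009, III §1 (base change of Weierstrass equations)] -/
theorem map_intCast_eq_map_intCast (W₀ : WeierstrassCurve ℤ) (f : A →+* C) (g : B →+* C) :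
    (W₀.map (Int.castRingHom A)).map f = (W₀.map (Int.castRingHom B)).map g := by
  rw [map_map_intCast, map_map_intCast]

end WeierstrassCurve

namespace Literature.NumberTheory.EllipticCurves

open WeierstrassCurve

variable {A B C D : Type*} [CommRing A] [CommRing B] [CommRing C] [CommRing D]

/-- The literal model `[1, −1, 0, −2, −1]` over `A` is the base change of the integer model. [cite: Cremona1997, Table 1 (curve 49a1)] -/
theorem cm7Model_eq_map_intCast : (⟨1, -1, 0, -2, -1⟩ : WeierstrassCurve A) = (⟨1, -1, 0, -2, -1⟩ : WeierstrassCurve ℤ).map (Int.castRingHom A) := by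
  ext <;> simp [WeierstrassCurve.map]

/-- ★ **`[1, −1, 0, −2, −1]^f = [1, −1, 0, −2, −1]`** for every ring map `f : A → B` (integer coefficients).
[cite: Cremona1997, Table 1 (curve 49a1)] [cite: SilvermanAEC2009, III §1] -/
theorem cm7Model_map (f : A →+* B) :
    (⟨1, -1, 0, -2, -1⟩ : WeierstrassCurve A).map f = (⟨1, -1, 0, -2, -1⟩ : WeierstrassCurve B) := by
  rw [cm7Model_eq_map_intCast, map_map_intCast, ← cm7Model_eq_map_intCast]

/-- `([1, −1, 0, −2, −1] ⊗ A)^f)^g = [1, −1, 0, −2, −1]` (two successive readings). [cite: Cremona1997, Table 1 (curve 49a1)] -/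
theorem cm7Model_map_map (f : A →+* B) (g : B →+* C) :
    ((⟨1, -1, 0, -2, -1⟩ : WeierstrassCurve A).map f).map g = (⟨1, -1, 0, -2, -1⟩ : WeierstrassCurve C) := by
  rw [cm7Model_map, cm7Model_map]

/-- ★ **The seam's model hypothesis `hW`**: the complex model of `49a1` read into `ℂ₂` (`(W_R^{φ_ℂ})^{τ}`) and its `ℤ₂`-model read into
`ℂ₂` (`(V^{e})^{φ_F}`) coincide — for ANY four ring maps `φ : R → C`, `τ : C → B`, `e : A → D`, `φ' : D → B`, since both are
`[1, −1, 0, −2, −1]` over `B`. [cite: Cremona1997, Table 1 (curve 49a1)] [cite: SilvermanAEC2009, III §1] -/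
theorem cm7Model_map_map_eq_map_map {R : Type*} [CommRing R] (φ : R →+* C) (τ : C →+* B) (e : A →+* D) (φ' : D →+* B) :
    ((⟨1, -1, 0, -2, -1⟩ : WeierstrassCurve R).map φ).map τ = ((⟨1, -1, 0, -2, -1⟩ : WeierstrassCurve A).map e).map φ' := by
  rw [cm7Model_map_map, cm7Model_map_map]

/-- The same with the second reading a single composite map (`V.map (e'.comp e)`, the shape `(V.map (eK⁻¹ ∘ Coe)).map φ_F` of the seam).
[cite: Cremona1997, Table 1 (curve 49a1)] -/
theorem cm7Model_map_map_eq_map_map' {R : Type*} [CommRing R] (φ : R →+* C) (τ : C →+* B) (e : A →+* D) (φ' : D →+* B) :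
    ((⟨1, -1, 0, -2, -1⟩ : WeierstrassCurve R).map φ).map τ = (⟨1, -1, 0, -2, -1⟩ : WeierstrassCurve A).map (φ'.comp e) := by
  rw [cm7Model_map_map, cm7Model_map]

/-! ### The invariants of `[1, −1, 0, −2, −1]` over an arbitrary commutative ring -/

/-- `a₁ = 1, a₂ = −1, a₃ = 0, a₄ = −2, a₆ = −1` (unfolding). [cite: Cremona1997, Table 1 (curve 49a1)] -/
theorem cm7Model_a :
    (⟨1, -1, 0, -2, -1⟩ : WeierstrassCurve A).a₁ = 1 ∧ (⟨1, -1, 0, -2, -1⟩ : WeierstrassCurve A).a₂ = -1 ∧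
      (⟨1, -1, 0, -2, -1⟩ : WeierstrassCurve A).a₃ = 0 ∧ (⟨1, -1, 0, -2, -1⟩ : WeierstrassCurve A).a₄ = -2 ∧
      (⟨1, -1, 0, -2, -1⟩ : WeierstrassCurve A).a₆ = -1 :=
  ⟨rfl, rfl, rfl, rfl, rfl⟩

/-- `b₂(49a1) = a₁² + 4a₂ = −3`. [cite: Cremona1997, Table 1 (curve 49a1)] -/
theorem cm7Model_b₂ : (⟨1, -1, 0, -2, -1⟩ : WeierstrassCurve A).b₂ = -3 := by
  norm_num [WeierstrassCurve.b₂]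

/-- `b₄(49a1) = 2a₄ + a₁a₃ = −4`. [cite: Cremona1997, Table 1 (curve 49a1)] -/
theorem cm7Model_b₄ : (⟨1, -1, 0, -2, -1⟩ : WeierstrassCurve A).b₄ = -4 := by
  norm_num [WeierstrassCurve.b₄]

/-- `b₆(49a1) = a₃² + 4a₆ = −4`. [cite: Cremona1997, Table 1 (curve 49a1)] -/
theorem cm7Model_b₆ : (⟨1, -1, 0, -2, -1⟩ : WeierstrassCurve A).b₆ = -4 := by
  norm_num [WeierstrassCurve.b₆]

/-- `b₈(49a1) = a₁²a₆ + 4a₂a₆ − a₁a₃a₄ + a₂a₃² − a₄² = −1`. [cite: Cremona1997, Table 1 (curve 49a1)] -/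
theorem cm7Model_b₈ : (⟨1, -1, 0, -2, -1⟩ : WeierstrassCurve A).b₈ = -1 := by
  norm_num [WeierstrassCurve.b₈]

/-- **`c₄(49a1) = b₂² − 24b₄ = 105`**. [cite: Cremona1997, Table 1 (curve 49a1)] -/
theorem cm7Model_c₄ : (⟨1, -1, 0, -2, -1⟩ : WeierstrassCurve A).c₄ = 105 := by
  rw [WeierstrassCurve.c₄, cm7Model_b₂, cm7Model_b₄]; norm_num

/-- **`c₆(49a1) = −b₂³ + 36b₂b₄ − 216b₆ = 1323 = 3³·7²`**. [cite: Cremona1997, Table 1 (curve 49a1)] -/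
theorem cm7Model_c₆ : (⟨1, -1, 0, -2, -1⟩ : WeierstrassCurve A).c₆ = 1323 := by
  rw [WeierstrassCurve.c₆, cm7Model_b₂, cm7Model_b₄, cm7Model_b₆]; norm_num

/-- **`Δ(49a1) = −343 = −7³`**. [cite: Cremona1997, Table 1 (curve 49a1: Δ = −343)] -/
theorem cm7Model_Δ : (⟨1, -1, 0, -2, -1⟩ : WeierstrassCurve A).Δ = -343 := by
  rw [WeierstrassCurve.Δ, cm7Model_b₂, cm7Model_b₄, cm7Model_b₆, cm7Model_b₈]; norm_num

/-- `Δ(49a1) = −7³`. [cite: Cremona1997, Table 1 (curve 49a1)] -/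
theorem cm7Model_Δ_eq_neg_pow : (⟨1, -1, 0, -2, -1⟩ : WeierstrassCurve A).Δ = -7 ^ 3 := by
  rw [cm7Model_Δ]; norm_num

/-- `c₄³ = j·Δ` with `j = −3375 = −15³`: `105³ = (−3375)·(−343)` (the `j`-invariant relation, division-free).
[cite: Cremona1997, Table 1 (curve 49a1: j = −3375)] -/
theorem cm7Model_c₄_pow_three : (⟨1, -1, 0, -2, -1⟩ : WeierstrassCurve A).c₄ ^ 3 = -3375 * (⟨1, -1, 0, -2, -1⟩ : WeierstrassCurve A).Δ := by
  rw [cm7Model_c₄, cm7Model_Δ]; norm_num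

/-! ### Characteristic zero: the Eisenstein pair of the Néron lattice and the `j`-invariant -/

section CharZero

variable {F : Type*} [Field F] [CharZero F]

/-- **`g₂ = c₄/12 = 35/4`** for `[1, −1, 0, −2, −1]` (the seam's `hg₂ : L.g₂ = W.c₄/12`). [cite: SilvermanATAEC1994, App. A §3 (D = −7)]
[cite: SilvermanAEC2009, III §1] -/
theorem cm7Model_c₄_div_twelve : (⟨1, -1, 0, -2, -1⟩ : WeierstrassCurve F).c₄ / 12 = 35 / 4 := by
  rw [cm7Model_c₄]; norm_num

/-- **`g₃ = c₆/216 = 49/8`** for `[1, −1, 0, −2, −1]` (the seam's `hg₃ : L.g₃ = W.c₆/216`). [cite: SilvermanATAEC1994, App. A §3 (D = −7)]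
[cite: SilvermanAEC2009, III §1] -/
theorem cm7Model_c₆_div : (⟨1, -1, 0, -2, -1⟩ : WeierstrassCurve F).c₆ / 216 = 49 / 8 := by
  rw [cm7Model_c₆]; norm_num

/-- `b₂/12 = −1/4` (the shift `x = ℘ − b₂/12` between the Weierstrass `x`-coordinate and `℘`). [cite: SilvermanAEC2009, III §1] -/
theorem cm7Model_b₂_div_twelve : (⟨1, -1, 0, -2, -1⟩ : WeierstrassCurve F).b₂ / 12 = -1 / 4 := by
  rw [cm7Model_b₂]; norm_num

/-- `g₂³ − 27g₃² = (c₄³ − c₆²)/1728 = Δ`: explicitly `(35/4)³ − 27·(49/8)² = −343` (the discriminant of the lattice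
`y² = 4x³ − g₂x − g₃` of the Néron differential of `49a1`). [cite: SilvermanAEC2009, III §1] -/
theorem cm7Model_g₂_pow_three_sub : ((35 / 4 : F)) ^ 3 - 27 * (49 / 8 : F) ^ 2 = -343 := by
  norm_num

/-- `[1, −1, 0, −2, −1]` is an elliptic curve in characteristic zero (`Δ = −343 ≠ 0`). [cite: Cremona1997, Table 1 (curve 49a1)] -/
theorem cm7Model_isElliptic : (⟨1, -1, 0, -2, -1⟩ : WeierstrassCurve F).IsElliptic := by
  rw [WeierstrassCurve.isElliptic_iff, cm7Model_Δ, isUnit_iff_ne_zero]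
  norm_num

/-- **`j(49a1) = −3375 = −15³`**. [cite: Cremona1997, Table 1 (curve 49a1: j = −3375)] [cite: SilvermanATAEC1994, App. A §3 (D = −7)] -/
theorem cm7Model_j : @WeierstrassCurve.j F _ ⟨1, -1, 0, -2, -1⟩ cm7Model_isElliptic = -3375 := by
  rw [WeierstrassCurve.j, Units.val_inv_eq_inv_val, WeierstrassCurve.coe_Δ', cm7Model_c₄, cm7Model_Δ]
  norm_num

end CharZero

end Literature.NumberTheory.EllipticCurves
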